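import Summits.BirchSwinnertonDyer.Rank1Residual.X11b.CensusPAdicLeadingTermBridge
import Summits.BirchSwinnertonDyer.Rank1Residual.X11b.RungK2Leaves
import Summits.BirchSwinnertonDyer.Rank1Residual.X11b.RegMultSplitThreeCertificate
import HarnessLib

/-!
# Route `ClassRecordThree`, split locus at 3: TIGHTNESS of the cyclotomic exceptional-zero road —
# the 𝓛-invariant relative leading term (`ClassClosure.RelativeExceptionalLeadingTermAt`) FOLLOWS
# from `BSD(E,p)` on the (ram) atom, at every odd prime (cell `bsd-stepL`, seat `mult-p4`)

Cell `bsd-stepL` (D-0131 (3) middle tier, seat `bsd-stepL-mult-p4`, strategy «split-multiplicative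
`r = 1` via the 𝓛-invariant `p`-adic Gross–Zagier + Kobayashi 2006 ⇒ B10»). THEOREMS ONLY: no
definition, no named fact, no `sorry`; every theorem is CONDITIONAL on the PUBLISHED named facts in
its binders (Skinner 2016 Thm. A `hA`, Stein–Wuthrich 2013 Thm. 6.1 split `hJs`, Gross–Zagier
I.(7.3) `hGZ`, rank `=` analytic rank `≤ 1` `hGZK`, and — for the forward direction only — SW §4.2
height existence `hHs` and modularity `hpar`). Nothing is booked; X11b stays CONSTRUCTION-SHAPED.

## What is proved

The cyclotomic exceptional-zero road to `BSD(E,p)` at a SPLIT multiplicative prime `p` runs through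
the EVIDENCE-labelled conjecture `X11b.ClassClosure.RelativeExceptionalLeadingTermAt W p`
(`X11b/ClassClosureTyped.lean`; Mazur–Tate–Teitelbaum's exceptional `p`-adic BSD display RELATIVE to
the classical one, `ϖ·[T²]L_p·(log_p γ)²·#T² = u·𝓛_p·#Ш_an·Reg_p·∏c_v`; in print = Disegni 2020
Thm. 4 second bullet for `p ≥ 5` with a second multiplicative prime, via Venerucci 2016 Thm. D;
at `p = 3` nothing is printed) and its consumer `ClassClosure.bsdp_three_of_splitThreeResidue_of_conjecture`
(conjecture + Schneider's non-degeneracy for THE split-canonical height ⟹ `BSD(E,3)`).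

This file proves the CONVERSE arrow, height-free:

1. `relativeLeadingTerm_of_padicVal_eq_split` (datum level, pure algebra over the two printed
   leading-term shapes): from the main-conjecture equality `ι(T·g·w) = ϖ·L` (Skinner's shape),
   Jones's three clauses for `g` (SW Thm. 6.1 split) and a rational `s ≠ 0` with
   `ord_p s = ord_p #Ш[p^∞]` (Miller's `BSD(E,p)` valuation clause), the relative display holds with
   an explicit unit — `u' = w(0)·u·#Ш[p^∞]/s` if `Reg_p(Dh) ≠ 0`, and TRIVIALLY (`0 = 0`, `u' = 1`)
   if `Reg_p(Dh) = 0`, because then `ord_T g ≥ 2` (Jones clause 2) forces `[T²](ϖL) = 0`.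
2. `relativeExceptionalLeadingTermAt_of_bsdp`: for every X11b pair (`r_an = 1`,
   `p ≠ 2`, `p ∥ N`, `E[p]` irreducible) with a (ram) prime, at EVERY odd `p` (so `p = 3` included):
   `BSD(E,p) → RelativeExceptionalLeadingTermAt W p`. NO Schneider / regulator hypothesis.
3. `relativeExceptionalLeadingTermAt_three_iff_bsdp_of_regulatorNonvanishing`: on the
   split residue at 3 (`SplitThreeResidueAt W`), GIVEN the per-pair regulator input
   `RegulatorNonvanishingAt W 3`, the conjecture is EQUIVALENT to `BSD(E,3)`.
4. `relativeExceptionalLeadingTermAt_three_of_multiplicativeRankOneAtThree`: the route's rung leaf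
   `X11b.MultiplicativeRankOneAtThree` (what `ClassRecordThree` closes) PROVES the conjecture at 3
   on every X11b pair with a (ram) prime — i.e. closing B10 by the BDP ∕ Kolyvagin roads turns the
   census-discovered display at `p = 3` (X11-REPORT v3: 150/150 split rank-one rows) into a theorem
   on the (ram) atom, with no `p`-adic height input.

## Reading (TIGHTNESS verdict for the cell's DO-NOT-TARGET list; nothing asserted about any curve)

On the (ram) ∧ split locus — ALL 961 TRUE-OPEN split classes of O2@3 are (ram) — the cyclotomic
𝓛-invariant road is DOMINATED as a closer: its analytic input (the exceptional-zero `p`-adic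
Gross–Zagier display at the pair, beyond print at 3) is IMPLIED by the target `BSD(E,3)` (item 2),
and implies it only modulo Schneider's non-degeneracy of the split-canonical 3-adic height (the
tree consumer; rung I1's open problem, per-pair certifiable). So an analytic proof of the display
at 3 (Venerucci Thm. D + Disegni Props. 4–5 pushed to `p = 3`) would close B10-split classes ONLY
modulo Schneider@3-split, never class-wide by itself; conversely the route `ClassRecordThree`
(roads (b)/(d): BDP value + IMC divisibility + Hsieh descent at 3, height-free) proves the display.
The same two arrows hold verbatim at every odd `p` on the (ram) atom of N8 (B9).

NOT here: the ¬(ram) "split-only" atom of N8 (`P2.bsdp_of_surj_split_odd_of_relativeLeadingTerm`;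
Skinner's equality needs (ram), Kato's divisibility alone gives no converse); any statement at
`p = 2`; any new fact. References: [Skinner2016PacificMC] Thm. A, §3.3; [SteinWuthrich2013]
Thm. 6.1, §4.2; [Disegni2020] Thm. 4 (§3.2), Props. 4–5 (§3.2.2); [Venerucci2015] Thm. D;
[GrossZagier1986] Thm. I.(7.3); [MazurTateTeitelbaum1986Invent] §II.10; [Miller2011LMS] Def. 1.1.
-/

set_option autoImplicit false

-- Theorems files of this problem live in `Summit.BirchSwinnertonDyer.BirchSwinnertonDyer.Theorems.*`.
set_option linter.dupNamespace false

noncomputable section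

open scoped Classical MatrixGroups ModularForm

open CongruenceSubgroup WeierstrassCurve Literature.NumberTheory.EllipticCurves
  Literature.NumberTheory.EllipticCurves.ModularForms
  Literature.NumberTheory.EllipticCurves.Rank1Residual
  Literature.NumberTheory.EllipticCurves.Rank1Residual.Typed
  Literature.NumberTheory.EllipticCurves.Skinner2016
  Literature.NumberTheory.EllipticCurves.SteinWuthrich2013

namespace Summit.BirchSwinnertonDyer.BirchSwinnertonDyer.Theorems.ExceptionalZeroRoad

open Summit.BirchSwinnertonDyer.Rank1Residual Summit.BirchSwinnertonDyer.Rank1Residual.X11b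

/-! ### §1 A `p`-adic unit from Miller's valuation clause -/

/-- **A rational with the valuation of a positive integer is that integer times a `p`-adic unit.**
If `s ∈ ℚ^×` and `ord_p s = ord_p S` for `S ≥ 1`, then `S = v·s` in `ℚ_p` for some `v ∈ ℤ_pˣ`.
Pure bookkeeping (the unit is `S/s`, of norm `p^{-ord_p S + ord_p s} = 1`). [folklore] -/
theorem exists_unit_natCast_eq_mul_ratCast {p : ℕ} [Fact p.Prime] {s : ℚ} (hs : s ≠ 0) {S : ℕ}
    (hS : S ≠ 0) (hval : padicValRat p s = padicValNat p S) :
    ∃ v : ℤ_[p]ˣ, (S : ℚ_[p]) = ((v : ℤ_[p]) : ℚ_[p]) * (s : ℚ_[p]) := by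
  have hsp : (s : ℚ_[p]) ≠ 0 := by exact_mod_cast hs
  -- the norm of `S/s` is `1`
  have hSp : (S : ℚ_[p]) ≠ 0 := by exact_mod_cast hS
  have hnorm : ‖(S : ℚ_[p]) / (s : ℚ_[p])‖ = 1 := by
    rw [norm_div, Padic.norm_eq_zpow_neg_valuation hSp, Padic.norm_eq_zpow_neg_valuation hsp,
      Padic.valuation_natCast, Padic.valuation_ratCast, hval]
    exact div_self (zpow_ne_zero _ (by exact_mod_cast (Fact.out : p.Prime).ne_zero))
  refine ⟨PadicInt.mkUnits hnorm, ?_⟩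
  rw [PadicInt.mkUnits_eq, div_mul_cancel₀ _ hsp]

/-! ### §2 Datum level: the relative display from the valuation clause (pure algebra) -/

section Datum

variable {W : WeierstrassCurve ℚ} [W.IsElliptic] [W.IsGloballyMinimal] {p : ℕ} [Fact p.Prime]
  {κ : ZpExtension ℚ p} {γ : Field.absoluteGaloisGroup ℚ}

/-- **The relative exceptional display from `BSD(E,p)`'s valuation clause (datum level).** At a
split multiplicative `p ≠ 2` in analytic rank one, with the cyclotomic pair `(κ, γ)`, `X(E/ℚ_∞)`
torsion with `char = (g)`, the main-conjecture equality in Skinner's exceptional shape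
`ι(T·g·w) = c·L` (`w ∈ Λˣ`), THE split-canonical §4.2 height `Dh`, and a rational `s ≠ 0` with
`ord_p s = ord_p #Ш(E/ℚ)[p^∞]` (Miller's clause): the relative display
`c·[T²]L·(log_p γ_cyc)²·#E(ℚ)_tors² = u'·𝓛_p·(s·Reg_p(Dh)·∏c_v)` holds for some `u' ∈ ℤ_pˣ`.
Proof: Jones (SW Thm. 6.1 split, `hJ`): `ord_T g ≥ 1`; if `Reg_p(Dh) ≠ 0` then (Ш finite by GZK)
`[T¹]g·(log_p γ)²·#T² = u·𝓛_p·#Ш[p^∞]·Reg_p·∏c_v`, and `c·[T²]L = [T¹]g·w(0)` gives the display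
with `u' = w(0)·u·(#Ш[p^∞]/s)`; if `Reg_p(Dh) = 0` then `ord_T g ≠ 1`, so `ord_T g ≥ 2`,
`c·[T²]L = 0` and both sides vanish (`u' = 1`). HEIGHT-FREE. CONDITIONAL on `hJ`, `hGZK`.
[cite: SteinWuthrich2013, Thm. 6.1 (p. 20) and §4.2] [cite: Skinner2016PacificMC, Thm. A and §3.3]
[cite: Miller2011LMS, Def. 1.1] -/
theorem relativeLeadingTerm_of_padicVal_eq_split (hJ : thm61_splitMultiplicative)
    (hGZK : rank_eq_analyticRank_of_analyticRank_le_one) (hp : p ≠ 2) (hr : W.analyticRank = 1)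
    (Dq : TateParameterData W p)
    (hκ : κ.IsCyclotomic) (hγ : κ.IsTopGenerator γ) (hγ' : IsCyclotomicVariable p γ)
    (D : W.SelmerDualData κ γ) (hX : D.IsTorsion) {g : IwasawaAlgebra p}
    (hchar : D.charIdeal = Ideal.span {g}) (w : (IwasawaAlgebra p)ˣ) {c : ℚ_[p]}
    {L : PowerSeries ℚ_[p]}
    (hw : iwasawaToPowerSeries p ((PowerSeries.X : IwasawaAlgebra p) * g * (w : IwasawaAlgebra p)) =
      PowerSeries.C c * L)
    (Dh : PAdicHeightData W p) (hDh : IsSplitMultCanonical Dh Dq)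
    {s : ℚ} (hs0 : s ≠ 0)
    (hval : padicValRat p s = padicValNat p (Nat.card (AddCommGroup.primaryComponent W.sha p))) :
    ∃ u' : ℤ_[p]ˣ, c * PowerSeries.coeff 2 L * padicLog p (cyclotomicGenerator p) ^ 2 *
        (W.torsionOrder : ℚ_[p]) ^ 2 =
      ((u' : ℤ_[p]) : ℚ_[p]) *
        (LInvariant Dq * ((s : ℚ_[p]) * padicRegulator Dh * W.tamagawaProduct)) := by
  haveI : Module.Finite (IwasawaAlgebra p) D.X := D.module_finite_holds hγ
  obtain ⟨hrank, hfin⟩ := hGZK W (by omega)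
  have hr1 : W.mordellWeilRank = 1 := by rw [hrank, hr]
  haveI : Finite W.sha := hfin
  haveI hfinp : Finite (AddCommGroup.primaryComponent W.sha p) := inferInstance
  -- Jones: clauses 1–3 at `r = 1`
  obtain ⟨hle, hiff, h3⟩ := hJ W p hp Dq κ γ hκ hγ hγ' D hX g hchar Dh hDh
  rw [hr1] at hle hiff h3
  -- `c · [T²]L = g₁ · w(0)`
  have hι : c * PowerSeries.coeff 2 L =
      ((PowerSeries.coeff 1 g * PowerSeries.constantCoeff (w : IwasawaAlgebra p) : ℤ_[p]) : ℚ_[p]) := by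
    have := coeff_eq_mul_constantCoeff_of_le_order (w : IwasawaAlgebra p) hle 1 (c := c) (L := L)
      (by simpa using hw)
    simpa using this
  by_cases hSch : SchneiderConjecture Dh
  · -- non-degenerate: transport the algebraic leading term through the unit `w(0)·u·#Ш[p^∞]/s`
    obtain ⟨u, hu⟩ := h3 hSch hfinp
    have hS : Nat.card (AddCommGroup.primaryComponent W.sha p) ≠ 0 := Nat.card_pos.ne'
    obtain ⟨v, hv⟩ := exists_unit_natCast_eq_mul_ratCast (p := p) hs0 hS hval
    have hwu : IsUnit (PowerSeries.constantCoeff (w : IwasawaAlgebra p)) :=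
      PowerSeries.isUnit_constantCoeff _ w.isUnit
    refine ⟨hwu.unit * u * v, ?_⟩
    have hw0 : (((hwu.unit * u * v : ℤ_[p]ˣ) : ℤ_[p]) : ℚ_[p]) =
        ((PowerSeries.constantCoeff (w : IwasawaAlgebra p) : ℤ_[p]) : ℚ_[p]) *
          ((u : ℤ_[p]) : ℚ_[p]) * ((v : ℤ_[p]) : ℚ_[p]) := by
      push_cast [Units.val_mul, IsUnit.unit_spec]
      ring
    rw [hw0]
    have hι' : c * PowerSeries.coeff 2 L =
        ((PowerSeries.coeff 1 g : ℤ_[p]) : ℚ_[p]) *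
          ((PowerSeries.constantCoeff (w : IwasawaAlgebra p) : ℤ_[p]) : ℚ_[p]) := by
      rw [hι]; push_cast; ring
    -- `c·[T²]L·B = w₀·(g₁·B) = w₀·u·𝓛·#S·Reg·∏c = w₀·u·𝓛·(v·s)·Reg·∏c`
    calc c * PowerSeries.coeff 2 L * padicLog p (cyclotomicGenerator p) ^ 2 *
          (W.torsionOrder : ℚ_[p]) ^ 2
        = ((PowerSeries.constantCoeff (w : IwasawaAlgebra p) : ℤ_[p]) : ℚ_[p]) *
            (((PowerSeries.coeff 1 g : ℤ_[p]) : ℚ_[p]) *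
              padicLog p (cyclotomicGenerator p) ^ (1 + 1) * (W.torsionOrder : ℚ_[p]) ^ 2) := by
          rw [hι']; ring
      _ = ((PowerSeries.constantCoeff (w : IwasawaAlgebra p) : ℤ_[p]) : ℚ_[p]) *
            (((u : ℤ_[p]) : ℚ_[p]) * (LInvariant Dq *
              ((Nat.card (AddCommGroup.primaryComponent W.sha p) : ℚ_[p]) *
                padicRegulator Dh * W.tamagawaProduct))) := by rw [hu]
      _ = ((PowerSeries.constantCoeff (w : IwasawaAlgebra p) : ℤ_[p]) : ℚ_[p]) *
            ((u : ℤ_[p]) : ℚ_[p]) * ((v : ℤ_[p]) : ℚ_[p]) *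
            (LInvariant Dq * ((s : ℚ_[p]) * padicRegulator Dh * W.tamagawaProduct)) := by
          rw [hv]; ring
  · -- degenerate: `ord_T g ≥ 2`, so `c·[T²]L = 0`, and `Reg_p(Dh) = 0`
    have hReg : padicRegulator Dh = 0 := by
      unfold SchneiderConjecture at hSch; exact not_not.mp hSch
    have hne : g.order ≠ ((1 : ℕ) : ℕ∞) := fun h => hSch (hiff.mp h).1
    have hlt : ((1 : ℕ) : ℕ∞) < g.order := lt_of_le_of_ne hle (Ne.symm hne)
    have hg1 : PowerSeries.coeff 1 g = 0 := PowerSeries.coeff_of_lt_order 1 hlt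
    refine ⟨1, ?_⟩
    rw [hι, hg1, hReg]
    simp

end Datum

/-! ### §3 Class level on the (ram) atom: the conjecture FROM `BSD(E,p)`, any odd `p` -/

section Class

variable (W : WeierstrassCurve ℚ) [W.IsElliptic] [W.IsGloballyMinimal] (p : ℕ) [Fact p.Prime]

/-- **TIGHTNESS of the exceptional-zero road on the (ram) atom, every odd `p` (so `p = 3`
included): `BSD(E,p) ⟹ RelativeExceptionalLeadingTermAt W p`.** For an X11b pair (`r_an = 1`,
`p ≠ 2`, `p ∥ N`, `E[p]` irreducible) with a (ram) prime, Miller's `BSD(E,p)` implies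
Mazur–Tate–Teitelbaum's exceptional relative display at the pair for EVERY newform `f`, `ϖ`,
Tate datum, MTT function `L` and split-canonical height `Dh` — from the PUBLISHED facts Skinner
2016 Thm. A (`hA`: main-conjecture equality at `p ∥ N`, `p ≥ 3`, (irr)+(ram), exceptional shape
`ι(T·g·w) = ϖ·L`), Stein–Wuthrich 2013 Thm. 6.1 split (`hJs`), Gross–Zagier I.(7.3) (`hGZ`:
`#Ш_an ∈ ℚ^×` in analytic rank one) and GZK (`hGZK`). NO `p`-adic height / Schneider hypothesis:
in the degenerate case both sides of the display vanish. The converse (display + Schneider ⟹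
`BSD(E,p)`) is the tree's `ClassClosure.bsdp_three_of_splitThreeResidue_of_conjecture` ∕
`bsdp_of_split_of_relativeLeadingTerm_of_schneider`. CONDITIONAL on the named facts; nothing
booked. [cite: Skinner2016PacificMC, Thm. A (§1), §3.3] [cite: SteinWuthrich2013, Thm. 6.1 (p. 20)]
[cite: GrossZagier1986, Thm. I.(7.3) 2)] [cite: Miller2011LMS, Def. 1.1]
[cite: MazurTateTeitelbaum1986Invent, §II.10 (exceptional case)] -/
theorem relativeExceptionalLeadingTermAt_of_bsdp
    (hA : thmA_charIdeal_multiplicative) (hJs : thm61_splitMultiplicative)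
    (hGZ : GrossZagier1986_thm_I_7_3) (hGZK : rank_eq_analyticRank_of_analyticRank_le_one)
    (hX : ClassX11b W p) (hram : Ram W p) (h : BSDp W p) :
    ClassClosure.RelativeExceptionalLeadingTermAt W p := by
  intro N _ f hp2 hsplit hr hf ϖ hϖ0 hϖ Dq L hL Dh hDh
  obtain ⟨-, -, hmult, hirr⟩ := hX
  have hpP : p.Prime := Fact.out
  have hp3 : 3 ≤ p := by
    rcases hpP.eq_two_or_odd' with h2 | hodd
    · exact absurd h2 hp2
    · obtain ⟨k, hk⟩ := hodd
      have := hpP.two_le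
      omega
  -- cyclotomic data and `X(E/ℚ_∞)`
  obtain ⟨κ, hκ, γ, hγ, hγ'⟩ := exists_isCyclotomic_isTopGenerator_isCyclotomicVariable_holds p
  obtain ⟨D⟩ := W.nonempty_selmerDualData_holds κ γ hγ
  -- Skinner Thm. A: torsion, generator, and the exceptional equality for THE function `L`
  obtain ⟨hXt, g, hchar, hsp, -⟩ := hA W p hp3 hmult hirr hram hκ hγ hγ' hf D ϖ hϖ0 hϖ
  obtain ⟨w, hw⟩ := hsp hsplit L hL
  -- `#Ш_an = s ∈ ℚ^×` (GZ) with Miller's valuation clause (BSD(E,p))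
  obtain ⟨-, -, s, hs, hval⟩ := h
  obtain ⟨s', hs'0, hs'⟩ := exists_rat_ne_zero_shaAn_eq_of_analyticRank_eq_one hGZ hGZK W hr
  have hss' : s = s' := by
    have : ((s : ℚ) : ℂ) = ((s' : ℚ) : ℂ) := hs.symm.trans hs'
    exact_mod_cast this
  have hs0 : s ≠ 0 := hss' ▸ hs'0
  obtain ⟨u', hu'⟩ := relativeLeadingTerm_of_padicVal_eq_split hJs hGZK hp2 hr Dq hκ hγ hγ' D hXt
    hchar w hw Dh hDh hs0 hval
  exact ⟨s, u', hs, hu'⟩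

/-- **At `p = 3`, on the split residue, GIVEN the per-pair regulator input: the conjecture is
EQUIVALENT to `BSD(E,3)`.** For an X11b pair at 3 split at 3 with a (ram) prime
(`SplitThreeResidueAt W`) and `RegulatorNonvanishingAt W 3` (Schneider for THE canonical data):
`RelativeExceptionalLeadingTermAt W 3 ↔ BSDp W 3` — forward = the tree's consumer
`ClassClosure.bsdp_three_of_splitThreeResidue_of_conjecture` (needs SW §4.2 height existence `hHs`
and modularity `hpar` to instantiate the data), backward = `relativeExceptionalLeadingTermAt_of_bsdp`
(height-free). CONDITIONAL on the named facts and on the per-pair input; nothing booked.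
[cite: Skinner2016PacificMC, Thm. A] [cite: SteinWuthrich2013, Thm. 6.1, §4.2]
[cite: GrossZagier1986, Thm. I.(7.3) 2)] [cite: Miller2011LMS, Def. 1.1] -/
theorem relativeExceptionalLeadingTermAt_three_iff_bsdp_of_regulatorNonvanishing
    [Fact (Nat.Prime 3)] (hA : thmA_charIdeal_multiplicative) (hJs : thm61_splitMultiplicative)
    (hHs : exists_isSplitMultCanonical) (hGZ : GrossZagier1986_thm_I_7_3)
    (hGZK : rank_eq_analyticRank_of_analyticRank_le_one) (hpar : nonempty_modularParametrizationData)
    (hX : ClassX11b W 3) (hres : ClassClosure.SplitThreeResidueAt W)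
    (hReg : ClassClosure.RegulatorNonvanishingAt W 3) :
    ClassClosure.RelativeExceptionalLeadingTermAt W 3 ↔ BSDp W 3 :=
  ⟨fun hC => ClassClosure.bsdp_three_of_splitThreeResidue_of_conjecture W hA hJs hHs hGZK hpar hX
      hres hC hReg,
    fun h => relativeExceptionalLeadingTermAt_of_bsdp W 3 hA hJs hGZ hGZK hX hres.2 h⟩

end Class

/-! ### §4 Route level: the rung leaf of `ClassRecordThree` proves the conjecture at 3 -/

/-- **What the route `ClassRecordThree` gives the exceptional-zero road.** The rung leaf
`X11b.MultiplicativeRankOneAtThree` (`BSD(E,3)` for every X11b pair at 3 — the statement the route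
closes, D-0061) implies the census-discovered conjecture `RelativeExceptionalLeadingTermAt W 3` for
every X11b pair at 3 with a (ram) prime (split pairs: the content; non-split pairs: vacuous), from
the published facts `hA`, `hJs`, `hGZ`, `hGZK` — with NO `p`-adic height input. So closing B10 by
the height-free roads (b)/(d) of the route proves the 𝓛-invariant display at 3 on the whole (ram)
atom (all 1 684 TRUE-OPEN classes of O2@3 are (ram); 961 of them split). CONDITIONAL on the named
facts and on the leaf taken as a hypothesis; nothing booked.
[cite: Skinner2016PacificMC, Thm. A] [cite: SteinWuthrich2013, Thm. 6.1]
[cite: GrossZagier1986, Thm. I.(7.3) 2)] [cite: Miller2011LMS, Def. 1.1] -/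
theorem relativeExceptionalLeadingTermAt_three_of_multiplicativeRankOneAtThree [Fact (Nat.Prime 3)]
    (hA : thmA_charIdeal_multiplicative) (hJs : thm61_splitMultiplicative)
    (hGZ : GrossZagier1986_thm_I_7_3) (hGZK : rank_eq_analyticRank_of_analyticRank_le_one)
    (hleaf : X11b.MultiplicativeRankOneAtThree)
    (W : WeierstrassCurve ℚ) [W.IsElliptic] [W.IsGloballyMinimal] (hX : ClassX11b W 3)
    (hram : Ram W 3) : ClassClosure.RelativeExceptionalLeadingTermAt W 3 :=
  relativeExceptionalLeadingTermAt_of_bsdp W 3 hA hJs hGZ hGZK hX hram (hleaf W hX)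

/-! ### §5 (appended) The equivalence with ONLY the split Schneider input -/

/-- **At `p = 3` on the split residue the conjecture is EQUIVALENT to `BSD(E,3)` given ONLY Schneider's
non-degeneracy for THE split-canonical §4.2 datum** (`∀ Dq Dh, IsSplitMultCanonical Dh Dq →
SchneiderConjecture Dh` — the SPLIT half of cc-typer-3's bundled `RegulatorNonvanishingAt W 3`; the
(4.1)-half is idle on a split curve): forward = the tree's
`ClassClosure.bsdp_three_of_splitThreeResidue_of_conjecture_of_schneiderSplit` (REG3B file), backward =
`relativeExceptionalLeadingTermAt_of_bsdp` (height-free). This is the literal form of the memo's verdict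
«the cyclotomic exceptional-zero road closes B10-split classes exactly modulo Schneider-split@3».
CONDITIONAL on the named facts and the per-pair input; nothing booked.
[cite: Skinner2016PacificMC, Thm. A] [cite: SteinWuthrich2013, Thm. 6.1, §4.2 (p. 16)]
[cite: GrossZagier1986, Thm. I.(7.3) 2)] [cite: Miller2011LMS, Def. 1.1] -/
theorem relativeExceptionalLeadingTermAt_three_iff_bsdp_of_schneiderSplit [Fact (Nat.Prime 3)]
    (hA : thmA_charIdeal_multiplicative) (hJs : thm61_splitMultiplicative)
    (hHs : exists_isSplitMultCanonical) (hGZ : GrossZagier1986_thm_I_7_3)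
    (hGZK : rank_eq_analyticRank_of_analyticRank_le_one) (hpar : nonempty_modularParametrizationData)
    (W : WeierstrassCurve ℚ) [W.IsElliptic] [W.IsGloballyMinimal] (hX : ClassX11b W 3)
    (hres : ClassClosure.SplitThreeResidueAt W)
    (hSch : ∀ (Dq : TateParameterData W 3) (Dh : PAdicHeightData W 3),
      IsSplitMultCanonical Dh Dq → SchneiderConjecture Dh) :
    ClassClosure.RelativeExceptionalLeadingTermAt W 3 ↔ BSDp W 3 :=
  ⟨fun hC => ClassClosure.bsdp_three_of_splitThreeResidue_of_conjecture_of_schneiderSplit W hA hJs hHs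
      hGZK hpar hX hres hC hSch,
    fun h => relativeExceptionalLeadingTermAt_of_bsdp W 3 hA hJs hGZ hGZK hX hres.2 h⟩

/-- **Without ANY height input the conjecture at 3 is still pinned from above by the target**: on the
split residue, `¬ RelativeExceptionalLeadingTermAt W 3 → ¬ BSDp W 3` — a (ram) split pair on which the
display failed (with `#Ш_an`) would refute `BSD(E,3)` given Skinner's Thm. A at 3 and Jones's clause;
the census rows (X11-REPORT v3, 150/150 at `p = 3`) are thus a consistency check of those `p = 3`
instances. Contrapositive of `relativeExceptionalLeadingTermAt_of_bsdp`; bookkeeping.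
[cite: Skinner2016PacificMC, Thm. A] [cite: SteinWuthrich2013, Thm. 6.1] [cite: Miller2011LMS, Def. 1.1] -/
theorem not_bsdp_three_of_not_relativeExceptionalLeadingTermAt [Fact (Nat.Prime 3)]
    (hA : thmA_charIdeal_multiplicative) (hJs : thm61_splitMultiplicative)
    (hGZ : GrossZagier1986_thm_I_7_3) (hGZK : rank_eq_analyticRank_of_analyticRank_le_one)
    (W : WeierstrassCurve ℚ) [W.IsElliptic] [W.IsGloballyMinimal] (hX : ClassX11b W 3)
    (hres : ClassClosure.SplitThreeResidueAt W)
    (hnot : ¬ ClassClosure.RelativeExceptionalLeadingTermAt W 3) : ¬ BSDp W 3 :=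
  fun h => hnot (relativeExceptionalLeadingTermAt_of_bsdp W 3 hA hJs hGZ hGZK hX hres.2 h)

end Summit.BirchSwinnertonDyer.BirchSwinnertonDyer.Theorems.ExceptionalZeroRoad

end
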